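import Literature.NumberTheory.Sieve.BombieriFriedlanderIwaniecDispersionLeaves
import Literature.NumberTheory.Sieve.BombieriFriedlanderIwaniecTheorem1Assembly
import Literature.NumberTheory.Sieve.BombieriFriedlanderIwaniecTheorem2
import Literature.NumberTheory.Sieve.BombieriFriedlanderIwaniecDispersionLemma7
import HarnessLib

/-!
# Bombieri–Friedlander–Iwaniec 1986, Theorem 10 (`ψ`- and `π`-form) from Lemma 1 alone

Topic `Literature/NumberTheory/Sieve`.  Everything here is PROVED; no named fact is introduced.

E. Bombieri, J. B. Friedlander, H. Iwaniec, *Primes in arithmetic progressions to large moduli*,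
Acta Math. 156 (1986), 203–251, Theorem 10 (p. 209): for `a ≠ 0`, `ε > 0`, `A > 0` and any
well-factorable `λ` of level `Q = x^{4/7−ε}`,
`∑_{(q,a)=1} λ(q) (ψ(x; q, a) − x/φ(q)) ≪_{a,A,ε} x (log x)^{−A}`
(named fact `BombieriFriedlanderIwaniecTheorem10`), and its `π`-form as restated by J. Maynard,
arXiv:2006.07088, p. 3, Theorem (Bombieri, Friedlander, Iwaniec) (named fact
`BombieriFriedlanderIwaniecTheorem10Pi`).

The tree proves the whole of BFI §§3–17 bearing on Theorem 10:
* Theorem 10 from Theorems 1, 2, 5 (`BombieriFriedlanderIwaniecTheorem10_of_theorem1_theorem2_theorem5`,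
  `…Theorem10Pi_of_theorem1_theorem2_theorem5`, file `…DispersionLeaves`: §§10, 13, 15, 17,
  Theorem 0, Lemma 3 = Shiu's theorem, Theorem 5* from Theorem 5, the `ψ → π` partial summation);
* Theorem 1 from Lemma 1 (`BombieriFriedlanderIwaniecTheorem1_of_lemma1`, file `…Theorem1Assembly`:
  the dispersion method §§3–8 and Lemma 6 from Lemma 1, file `…Lemma6`);
* Theorem 2 from Lemma 7 (`BFI.BombieriFriedlanderIwaniecTheorem2_of_lemma7`, file `…Theorem2`:
  §9) and Lemma 7 from Lemma 1 (`BFI.lemma7_dispBm_of_lemma1`, file `…DispersionLemma7`);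
* Theorem 5 from Lemma 1 (`BombieriFriedlanderIwaniecTheorem5_of_lemma1`, file `…Lemma6`: §12 and
  Lemma 6).

This file composes them: **Theorem 10 in all its tree forms is conditional on exactly BFI's
Lemma 1** (§2, p. 210) — J.-M. Deshouillers, H. Iwaniec, *Kloosterman sums and Fourier
coefficients of cusp forms*, Invent. Math. 70 (1982), 219–288, Theorem 12 (Kuznetsov's formula and
the spectral theory of `Γ₀(rs)∖ℍ`, in neither Mathlib nor the tree) — needed only for the single
smooth weight `w ⊗ w` (`BFI.plateau2`, supported in `[1/4, 5/4]²`) in the ranges `C, D, N ≥ 1`,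
`R, S ≥ 1/2`, i.e. the hypothesis `BFI.Lemma1BoundFor BFI.plateau2 (5/4)` of `…Lemma6`
(unprimed statements), or in its printed form quantified over all smooth weights of compact
support in `ℝ⁺ × ℝ⁺` (primed statements, support rendered as a box `[a, b]²`, `0 < a ≤ b`, as in
`BombieriFriedlanderIwaniecTheorem5_of_lemma1'`).

## Main statements

* `BFI.Theorem10Dyadic_of_lemma1` — the dyadic form (15.1) for the weights of Theorem 10;
* `BombieriFriedlanderIwaniecTheorem10_of_lemma1` — Theorem 10 as printed (`ψ`-form, p. 209);
* `bfi_wellFactorable_level_of_lemma1` — the tree's fact `bfi_wellFactorable_level`;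
* `BombieriFriedlanderIwaniecTheorem10Pi_of_lemma1` — Maynard's `π`-form;
* `BombieriFriedlanderIwaniecTheorem10_of_lemma1'`, `BombieriFriedlanderIwaniecTheorem10Pi_of_lemma1'`
  — the same from the printed (all smooth weights) form of Lemma 1.

## References

* E. Bombieri, J. B. Friedlander, H. Iwaniec, Acta Math. 156 (1986), 203–251: Theorem 10 p. 209;
  §2 Lemma 1 p. 210; Theorems 1, 2, 5, pp. 225, 230, 237; Lemmas 6, 7, pp. 227, 230.
  [BombieriFriedlanderIwaniecActa1986]
* J. Maynard, *Primes in arithmetic progressions to large moduli II: Well-factorable estimates*,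
  arXiv:2006.07088, p. 3, Theorem (Bombieri, Friedlander, Iwaniec). [Maynard2020LargeModuliII]
* J.-M. Deshouillers, H. Iwaniec, Invent. Math. 70 (1982), 219–288, Theorem 12 (BFI's
  reference [2]).
-/

namespace Literature.NumberTheory.Sieve

open scoped ContDiff

/-! ### From Lemma 1 for the weight `w ⊗ w` -/

/-- **BFI Theorem 2 (§9, p. 230) from Lemma 1** for the weight `w ⊗ w`: the composition of the
tree's `BFI.BombieriFriedlanderIwaniecTheorem2_of_lemma7` (Theorem 2 from Lemma 7 for `𝓑_m`) with
`BFI.lemma7_dispBm_of_lemma1` (Lemma 7 from Lemma 1), stated here as the term feeding Theorem 10.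
[cite: BombieriFriedlanderIwaniecActa1986, §9 Theorem 2 p. 230, Lemma 7 p. 230; §2 Lemma 1 p. 210] -/
theorem BFI.theorem2_of_lemma1_plateau (hLB : BFI.Lemma1BoundFor BFI.plateau2 (5 / 4)) :
    BombieriFriedlanderIwaniecTheorem2 :=
  BFI.BombieriFriedlanderIwaniecTheorem2_of_lemma7 (BFI.lemma7_dispBm_of_lemma1 hLB)

/-- **The dyadic form of BFI Theorem 10 ((15.1), p. 244, for the weights of Theorem 10) from
Lemma 1** for the weight `w ⊗ w`: Theorems 1, 2, 5 being theorems of the tree conditionally on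
that single bound (`BombieriFriedlanderIwaniecTheorem1_of_lemma1`,
`BFI.BombieriFriedlanderIwaniecTheorem2_of_lemma7 ∘ BFI.lemma7_dispBm_of_lemma1`,
`BombieriFriedlanderIwaniecTheorem5_of_lemma1`).
[cite: BombieriFriedlanderIwaniecActa1986, §15 (15.1) p. 244; §2 Lemma 1 p. 210] -/
theorem BFI.Theorem10Dyadic_of_lemma1 (hLB : BFI.Lemma1BoundFor BFI.plateau2 (5 / 4)) :
    BFI.Theorem10Dyadic :=
  BFI.Theorem10Dyadic_of_theorem1_theorem2_theorem5 (BombieriFriedlanderIwaniecTheorem1_of_lemma1 hLB)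
    (BFI.theorem2_of_lemma1_plateau hLB) (BombieriFriedlanderIwaniecTheorem5_of_lemma1 hLB)

/-- **BFI Theorem 10 as printed (p. 209: level `x^{4/7−ε}` for well-factorable weights, `ψ`-form)
from Lemma 1 alone** (for the weight `w ⊗ w`, ranges `C, D, N ≥ 1`, `R, S ≥ 1/2`): the complete
reduction of the source's main theorem to its single external input, Deshouillers–Iwaniec's
Theorem 12 — all of BFI §§3–17 (Theorem 0, Lemmas 2–9, Theorems 1, 2, 5, 5*, the sieve identity,
§§15, 17) being theorems of the tree.
[cite: BombieriFriedlanderIwaniecActa1986, Theorem 10 p. 209; §2 Lemma 1 p. 210] -/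
theorem BombieriFriedlanderIwaniecTheorem10_of_lemma1 (hLB : BFI.Lemma1BoundFor BFI.plateau2 (5 / 4)) :
    BombieriFriedlanderIwaniecTheorem10 :=
  BombieriFriedlanderIwaniecTheorem10_of_theorem1_theorem2_theorem5
    (BombieriFriedlanderIwaniecTheorem1_of_lemma1 hLB) (BFI.theorem2_of_lemma1_plateau hLB)
    (BombieriFriedlanderIwaniecTheorem5_of_lemma1 hLB)

/-- **The tree's fact `bfi_wellFactorable_level` from Lemma 1 alone.**
[cite: BombieriFriedlanderIwaniecActa1986, Theorem 10 p. 209; §2 Lemma 1 p. 210] -/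
theorem bfi_wellFactorable_level_of_lemma1 (hLB : BFI.Lemma1BoundFor BFI.plateau2 (5 / 4)) :
    bfi_wellFactorable_level :=
  bfi_wellFactorable_level_of_theorem10 (BombieriFriedlanderIwaniecTheorem10_of_lemma1 hLB)

/-- **BFI Theorem 10, `π`-form (Maynard, arXiv:2006.07088, p. 3, Theorem (Bombieri–Friedlander–
Iwaniec)) from Lemma 1 alone**: Maynard's restatement "Let `a ∈ ℤ` and `A, ε > 0`. Let `λ_q` be
well-factorable of level `Q ≤ x^{4/7−ε}`. Then `∑_{q≤Q,(q,a)=1} λ_q (π(x;q,a) − π(x)/φ(q))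
≪_{a,A,ε} x/(log x)^A`" (named fact `BombieriFriedlanderIwaniecTheorem10Pi`, `a ≠ 0`) is
conditional on exactly BFI's Lemma 1 = Deshouillers–Iwaniec, Invent. Math. 70 (1982), Theorem 12,
for the one weight `w ⊗ w` — through the printed `ψ`-form (`BombieriFriedlanderIwaniecTheorem10_of_lemma1`)
and the partial-summation passage `BombieriFriedlanderIwaniecTheorem10Pi_of_theorem10`.
[cite: Maynard2020LargeModuliII, p. 3, Theorem (Bombieri–Friedlander–Iwaniec);
BombieriFriedlanderIwaniecActa1986, Theorem 10 p. 209, §2 Lemma 1 p. 210] -/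
theorem BombieriFriedlanderIwaniecTheorem10Pi_of_lemma1 (hLB : BFI.Lemma1BoundFor BFI.plateau2 (5 / 4)) :
    BombieriFriedlanderIwaniecTheorem10Pi :=
  BombieriFriedlanderIwaniecTheorem10Pi_of_theorem10 (BombieriFriedlanderIwaniecTheorem10_of_lemma1 hLB)

/-! ### From the printed form of Lemma 1 (all smooth weights of compact support in `ℝ⁺ × ℝ⁺`) -/

/-- The printed Lemma 1 (all smooth `g₀` supported in a box `[a, b]²`, `0 < a ≤ b`) contains the
instance `g₀ = w ⊗ w`, `[a, b] = [1/4, 5/4]` used throughout the tree.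
[cite: BombieriFriedlanderIwaniecActa1986, §2 Lemma 1 p. 210] -/
theorem BFI.lemma1BoundFor_plateau2_of_printed
    (h1 : ∀ g₀ : ℝ → ℝ → ℝ, ContDiff ℝ ∞ (fun p : ℝ × ℝ => g₀ p.1 p.2) →
      ∀ a b : ℝ, 0 < a → a ≤ b →
        (∀ ξ η : ℝ, ¬ (ξ ∈ Set.Icc a b ∧ η ∈ Set.Icc a b) → g₀ ξ η = 0) →
          BFI.Lemma1BoundFor g₀ b) :
    BFI.Lemma1BoundFor BFI.plateau2 (5 / 4) :=
  h1 BFI.plateau2 BFI.contDiff_plateau2 (1 / 4) (5 / 4) (by norm_num) (by norm_num)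
    fun _ _ h => BFI.plateau2_eq_zero h

/-- **BFI Theorem 10 as printed (p. 209) from the printed Lemma 1** (quantified over all smooth
weights of compact support in `ℝ⁺ × ℝ⁺`, rendered as support in a box `[a, b]²`, `0 < a ≤ b`).
[cite: BombieriFriedlanderIwaniecActa1986, Theorem 10 p. 209; §2 Lemma 1 p. 210] -/
theorem BombieriFriedlanderIwaniecTheorem10_of_lemma1'
    (h1 : ∀ g₀ : ℝ → ℝ → ℝ, ContDiff ℝ ∞ (fun p : ℝ × ℝ => g₀ p.1 p.2) →
      ∀ a b : ℝ, 0 < a → a ≤ b →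
        (∀ ξ η : ℝ, ¬ (ξ ∈ Set.Icc a b ∧ η ∈ Set.Icc a b) → g₀ ξ η = 0) →
          BFI.Lemma1BoundFor g₀ b) :
    BombieriFriedlanderIwaniecTheorem10 :=
  BombieriFriedlanderIwaniecTheorem10_of_lemma1 (BFI.lemma1BoundFor_plateau2_of_printed h1)

/-- **BFI Theorem 10, `π`-form (Maynard, arXiv:2006.07088, p. 3) from the printed Lemma 1**
(quantified over all smooth weights of compact support in `ℝ⁺ × ℝ⁺`).
[cite: Maynard2020LargeModuliII, p. 3, Theorem (Bombieri–Friedlander–Iwaniec);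
BombieriFriedlanderIwaniecActa1986, §2 Lemma 1 p. 210] -/
theorem BombieriFriedlanderIwaniecTheorem10Pi_of_lemma1'
    (h1 : ∀ g₀ : ℝ → ℝ → ℝ, ContDiff ℝ ∞ (fun p : ℝ × ℝ => g₀ p.1 p.2) →
      ∀ a b : ℝ, 0 < a → a ≤ b →
        (∀ ξ η : ℝ, ¬ (ξ ∈ Set.Icc a b ∧ η ∈ Set.Icc a b) → g₀ ξ η = 0) →
          BFI.Lemma1BoundFor g₀ b) :
    BombieriFriedlanderIwaniecTheorem10Pi :=
  BombieriFriedlanderIwaniecTheorem10Pi_of_lemma1 (BFI.lemma1BoundFor_plateau2_of_printed h1)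

end Literature.NumberTheory.Sieve
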